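import Mathlib
import HarnessLib

/-!
# Harmonic analysis on a finite product space with the uniform product measure: averaging operators, Efron–Stein parts, Laplacians, derivatives, noise

Infrastructure for the Keller–Lifshitz–Marcus sharp hypercontractive and level-`d` inequalities on
product spaces (N. Keller, N. Lifshitz, O. Marcus, *Sharp hypercontractivity for global functions*,
arXiv:2307.01356 = J. Eur. Math. Soc. 2026 [KellerLifshitzMarcus2023], **§2.2 "Functions over general
finite product spaces"**: the operators `E_S`, the Laplacians `L_S`, the Efron–Stein decomposition
`f = ∑_S f^{=S}`, restrictions `f_{S→x}`, derivatives `D_{S,x} f = (L_S f)_{S→x}`, the noise operator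
`T_ρ f = ∑_S ρ^{|S|} f^{=S}` (eq. (2.1)), Lemma 2.1 and Lemma 2.2), written for a GENERAL dependent
product `X = Π_{i : ι} α i` of non-empty finite types with the UNIFORM product measure (the case the
tree's consumers need: `[m]^N`, and the mixed spaces `[m]^N × {0,1}^{N×(m-1)}` of the Rademacher
encodings in `ProductSpaceHypercontractivity.lean`). Everything is a finite sum; expectations are
`(∑ x, ·) / |X|`.

Contents (all PROVED; no named facts):
* `condAvg A f = E_A f` — averaging over the coordinates in `A` (`(E_A f)(x) = |X|⁻¹ ∑_y f(y on A, x off A)`,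
  via `Finset.piecewise`); the counting identity `sum_sum_piecewise`; `E_∅ = id`, `E_A E_B = E_{A∪B}`,
  self-adjointness, `E_A` fixes functions not depending on `A` (`DependsOff`), pull-through;
* `esPart T f = f^{=T} := ∑_{R⊆T} (-1)^{|T|+|R|} E_{Rᶜ} f` — the Efron–Stein part; `sum_esPart` (`f = ∑_T f^{=T}`),
  `condAvg_esPart` (`E_A f^{=T} = 0` if `A ∩ T ≠ ∅`, `= f^{=T}` if disjoint), `esPart_condAvg`
  (`(E_A f)^{=T} = [A ∩ T = ∅] f^{=T}`, KLM §2.2 item 2), orthogonality `sum_esPart_mul_esPart`,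
  `esPart_esPart` (idempotence/uniqueness);
* `lap S f = L_S f := ∑_{R⊆S} (-1)^{|R|} E_R f` with `esPart_lap` (`(L_S f)^{=T} = [S ⊆ T] f^{=T}`, KLM §2.2
  item 2: `L_S f = ∑_{T ⊇ S} f^{=T}`);
* `noiseOn ρ A f := ∑_T ρ^{|T∩A|} f^{=T}` — noise on the coordinate set `A` (`A = univ`: `T_ρ`, eq. (2.1)),
  `esPart_noiseOn`, semigroup law, `noiseOn_insert` (product of one-coordinate operators
  `E_i + ρ L_i`), commutation with `E_B`/`L_S` (Lemma 2.2, first half);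
* `restr S y f = f_{S→y}` (as a function on all of `X`, constant in the `S`-coordinates) and
  `deriv S y f = D_{S,y} f := (L_S f)_{S→y}`; the RESTRICTION LEMMA `restr_esPart`
  (`(f^{=T})_{i→a} = (D_{i,a} f)^{=T∖i}` for `i ∈ T`), `deriv_noiseOn` (Lemma 2.2, second half:
  `D_{S,x} T_ρ f = ρ^{|S|} T_ρ D_{S,x} f`), `deriv_deriv` (iterated derivatives);
* `esLevel d f = f^{=d} := ∑_{|T| = d} f^{=T}` with `noiseOn_univ_esLevel` (`T_ρ f^{=d} = ρ^d f^{=d}`) and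
  `deriv_esLevel` (`D_{i,x}[f^{=d}] = (D_{i,x} f)^{=d-1}`, the identity behind KLM Thm 5.2's induction).

No instances, no notation; standard axioms. WHAT THIS IS NOT: no inequality is proved here (the
hypercontractive and level-`d` inequalities are in the sibling files); nothing about `S_n`, matchings or
psd rank; no P-vs-NP content.
-/

noncomputable section

namespace Literature.Combinatorics.Additive.ProductSpace

open Finset

variable {ι : Type*} [Fintype ι] [DecidableEq ι] {α : ι → Type*} [∀ i, Fintype (α i)]

/-! ## The product space and the averaging operators `E_A` -/

/-- The number of points of the product space `X = Π_i α i`, as a real number.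
[cite: KellerLifshitzMarcus2023, §2.2 (the product measure `μ = ⊗ μ_i`, here uniform)] -/
def cardX (α : ι → Type*) [∀ i, Fintype (α i)] : ℝ := Fintype.card ((i : ι) → α i)

/-- [cite: KellerLifshitzMarcus2023, §2.2] -/
theorem cardX_pos [∀ i, Nonempty (α i)] : 0 < cardX α := by
  unfold cardX
  exact_mod_cast Fintype.card_pos

/-- **`E_A`**: averaging over the coordinates in `A` (uniform measure):
`(E_A f)(x) = |X|⁻¹ ∑_{y ∈ X} f(A.piecewise y x)` (each point agreeing with `x` off `A` is hit equally often).
[cite: KellerLifshitzMarcus2023, §2.2 ("`E_S f` … the expectation over the coordinates in `S`")] -/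
def condAvg (A : Finset ι) (f : ((i : ι) → α i) → ℝ) (x : (i : ι) → α i) : ℝ :=
  (∑ y : (i : ι) → α i, f (A.piecewise y x)) / cardX α

/-- Swapping the `A`-parts of a pair of points is an involution of `X × X`. [folklore] -/
def swapOn (A : Finset ι) : ((i : ι) → α i) × ((i : ι) → α i) ≃ ((i : ι) → α i) × ((i : ι) → α i) where
  toFun p := (A.piecewise p.2 p.1, A.piecewise p.1 p.2)
  invFun p := (A.piecewise p.2 p.1, A.piecewise p.1 p.2)
  left_inv p := by
    rcases p with ⟨x, y⟩
    ext i <;> by_cases hi : i ∈ A <;> simp [Finset.piecewise, hi]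
  right_inv p := by
    rcases p with ⟨x, y⟩
    ext i <;> by_cases hi : i ∈ A <;> simp [Finset.piecewise, hi]

/-- **Counting identity**: `∑_x ∑_y Φ(A.piecewise y x) = |X| · ∑_z Φ(z)`.
[cite: KellerLifshitzMarcus2023, §2.2 (product structure of the uniform measure)] -/
theorem sum_sum_piecewise (A : Finset ι) (Φ : ((i : ι) → α i) → ℝ) :
    ∑ x : (i : ι) → α i, ∑ y : (i : ι) → α i, Φ (A.piecewise y x) = cardX α * ∑ z, Φ z := by
  have h1 : ∑ x : (i : ι) → α i, ∑ y : (i : ι) → α i, Φ (A.piecewise y x) =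
      ∑ p : ((i : ι) → α i) × ((i : ι) → α i), Φ ((swapOn A p).1) := by
    rw [Fintype.sum_prod_type]
    rfl
  rw [h1, Equiv.sum_comp (swapOn A) (fun p => Φ p.1), Fintype.sum_prod_type]
  simp only [Finset.sum_const, Finset.card_univ, nsmul_eq_mul]
  rw [cardX, Finset.mul_sum]

/-- `E_∅ = id`. [cite: KellerLifshitzMarcus2023, §2.2] -/
theorem condAvg_empty [∀ i, Nonempty (α i)] (f : ((i : ι) → α i) → ℝ) : condAvg ∅ f = f := by
  funext x
  unfold condAvg cardX
  simp only [Finset.piecewise_empty, Finset.sum_const, Finset.card_univ, nsmul_eq_mul]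
  have h : (Fintype.card ((i : ι) → α i) : ℝ) ≠ 0 := by exact_mod_cast Fintype.card_ne_zero
  field_simp

omit [Fintype ι] [∀ i, Fintype (α i)] in
/-- Nested piecewise: `B`-part from `z`, then `A`-part from `y`, is the `(A ∪ B)`-part from `B.piecewise z y`.
[folklore] -/
private theorem piecewise_piecewise_eq_union (A B : Finset ι) (x y z : (i : ι) → α i) :
    B.piecewise z (A.piecewise y x) = (A ∪ B).piecewise (B.piecewise z y) x := by
  funext i
  by_cases hB : i ∈ B <;> by_cases hA : i ∈ A <;> simp [Finset.piecewise, hA, hB]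

/-- **`E_A E_B = E_{A ∪ B}`** (in particular the `E_A` commute and are idempotent).
[cite: KellerLifshitzMarcus2023, §2.2] -/
theorem condAvg_condAvg [∀ i, Nonempty (α i)] (A B : Finset ι) (f : ((i : ι) → α i) → ℝ) :
    condAvg A (condAvg B f) = condAvg (A ∪ B) f := by
  funext x
  unfold condAvg
  rw [← Finset.sum_div, div_div]
  simp_rw [piecewise_piecewise_eq_union A B x]
  have h := sum_sum_piecewise B (fun u => f ((A ∪ B).piecewise u x))
  rw [h, mul_comm, mul_div_mul_right _ _ cardX_pos.ne']

/-- [cite: KellerLifshitzMarcus2023, §2.2] -/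
theorem condAvg_comm [∀ i, Nonempty (α i)] (A B : Finset ι) (f : ((i : ι) → α i) → ℝ) :
    condAvg A (condAvg B f) = condAvg B (condAvg A f) := by
  rw [condAvg_condAvg, condAvg_condAvg, Finset.union_comm]

/-- [cite: KellerLifshitzMarcus2023, §2.2] -/
theorem condAvg_idem [∀ i, Nonempty (α i)] (A : Finset ι) (f : ((i : ι) → α i) → ℝ) :
    condAvg A (condAvg A f) = condAvg A f := by
  rw [condAvg_condAvg, Finset.union_idempotent]

/-- `f` **does not depend on the coordinates in `A`**. [cite: KellerLifshitzMarcus2023, §2.2 (juntas / `V^{=T}`)] -/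
def DependsOff (A : Finset ι) (f : ((i : ι) → α i) → ℝ) : Prop :=
  ∀ x y : (i : ι) → α i, (∀ i, i ∉ A → x i = y i) → f x = f y

omit [Fintype ι] [DecidableEq ι] [∀ i, Fintype (α i)] in
/-- [cite: KellerLifshitzMarcus2023, §2.2] -/
theorem DependsOff.mono {A B : Finset ι} {f : ((i : ι) → α i) → ℝ} (h : DependsOff A f) (hBA : B ⊆ A) :
    DependsOff B f :=
  fun x y hxy => h x y fun i hi => hxy i fun hB => hi (hBA hB)

omit [Fintype ι] [∀ i, Fintype (α i)] in
/-- [cite: KellerLifshitzMarcus2023, §2.2] -/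
theorem DependsOff.piecewise {A : Finset ι} {f : ((i : ι) → α i) → ℝ} (h : DependsOff A f)
    (x y : (i : ι) → α i) : f (A.piecewise y x) = f x :=
  h _ _ fun i hi => by simp [Finset.piecewise, hi]

/-- `E_A f` does not depend on the `A`-coordinates. [cite: KellerLifshitzMarcus2023, §2.2] -/
theorem dependsOff_condAvg (A : Finset ι) (f : ((i : ι) → α i) → ℝ) : DependsOff A (condAvg A f) := by
  intro x x' hxx'
  unfold condAvg
  congr 1
  refine Finset.sum_congr rfl fun y _ => ?_
  congr 1
  funext i
  by_cases hi : i ∈ A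
  · simp [Finset.piecewise, hi]
  · simp [Finset.piecewise, hi, hxx' i hi]

/-- More generally `E_A f` does not depend on `B` whenever `f` does not depend on `B ∖ A`.
[cite: KellerLifshitzMarcus2023, §2.2] -/
theorem dependsOff_condAvg_of_sdiff {A B : Finset ι} {f : ((i : ι) → α i) → ℝ} (h : DependsOff (B \ A) f) :
    DependsOff B (condAvg A f) := by
  intro x x' hxx'
  unfold ProductSpace.condAvg
  congr 1
  refine Finset.sum_congr rfl fun y _ => h _ _ fun i hi => ?_
  rw [Finset.mem_sdiff, not_and, not_not] at hi
  by_cases hiA : i ∈ A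
  · simp [Finset.piecewise, hiA]
  · have hiB : i ∉ B := fun hB => hiA (hi hB)
    simp [Finset.piecewise, hiA, hxx' i hiB]

/-- If `f` does not depend on `A` then `E_A f = f`. [cite: KellerLifshitzMarcus2023, §2.2] -/
theorem DependsOff.condAvg_eq [∀ i, Nonempty (α i)] {A : Finset ι} {f : ((i : ι) → α i) → ℝ}
    (h : DependsOff A f) : condAvg A f = f := by
  funext x
  unfold ProductSpace.condAvg
  simp_rw [h.piecewise]
  have hc : cardX α ≠ 0 := cardX_pos.ne'
  rw [Finset.sum_const, Finset.card_univ, nsmul_eq_mul, ← cardX]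
  field_simp

/-- **Pull-through**: a factor not depending on `A` comes out of `E_A`.
[cite: KellerLifshitzMarcus2023, §2.2] -/
theorem condAvg_mul_of_dependsOff {A : Finset ι} {g : ((i : ι) → α i) → ℝ} (hg : DependsOff A g)
    (f : ((i : ι) → α i) → ℝ) : condAvg A (fun x => g x * f x) = fun x => g x * condAvg A f x := by
  funext x
  unfold condAvg
  simp_rw [hg.piecewise]
  rw [← Finset.mul_sum, mul_div_assoc]

/-- `E_A` is linear: sums. [cite: KellerLifshitzMarcus2023, §2.2] -/
theorem condAvg_add (A : Finset ι) (f g : ((i : ι) → α i) → ℝ) :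
    condAvg A (fun x => f x + g x) = fun x => condAvg A f x + condAvg A g x := by
  funext x; unfold condAvg; rw [← add_div, ← Finset.sum_add_distrib]

/-- `E_A` is linear: scalars. [cite: KellerLifshitzMarcus2023, §2.2] -/
theorem condAvg_smul (A : Finset ι) (c : ℝ) (f : ((i : ι) → α i) → ℝ) :
    condAvg A (fun x => c * f x) = fun x => c * condAvg A f x := by
  funext x; unfold condAvg; rw [← Finset.mul_sum, mul_div_assoc]

/-- [cite: KellerLifshitzMarcus2023, §2.2] -/
theorem condAvg_neg (A : Finset ι) (f : ((i : ι) → α i) → ℝ) :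
    condAvg A (fun x => -f x) = fun x => -condAvg A f x := by
  funext x; unfold condAvg; rw [← neg_div, ← Finset.sum_neg_distrib]

/-- [cite: KellerLifshitzMarcus2023, §2.2] -/
theorem condAvg_sub (A : Finset ι) (f g : ((i : ι) → α i) → ℝ) :
    condAvg A (fun x => f x - g x) = fun x => condAvg A f x - condAvg A g x := by
  funext x; unfold condAvg; rw [← sub_div, ← Finset.sum_sub_distrib]

/-- [cite: KellerLifshitzMarcus2023, §2.2] -/
theorem condAvg_zero (A : Finset ι) : condAvg A (fun _ : (i : ι) → α i => (0 : ℝ)) = fun _ => 0 := by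
  funext x; simp [condAvg]

/-- `E_A` of a finite sum of functions. [cite: KellerLifshitzMarcus2023, §2.2] -/
theorem condAvg_finset_sum {κ : Type*} (s : Finset κ) (A : Finset ι) (F : κ → ((i : ι) → α i) → ℝ) :
    condAvg A (fun x => ∑ k ∈ s, F k x) = fun x => ∑ k ∈ s, condAvg A (F k) x := by
  funext x
  unfold condAvg
  rw [Finset.sum_comm, Finset.sum_div]

/-- **Self-adjointness of `E_A`**: `∑_x g(x) (E_A f)(x) = ∑_x (E_A g)(x) f(x)`.
[cite: KellerLifshitzMarcus2023, §2.2] -/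
theorem sum_mul_condAvg (A : Finset ι) (f g : ((i : ι) → α i) → ℝ) :
    ∑ x, g x * condAvg A f x = ∑ x, condAvg A g x * f x := by
  unfold condAvg
  simp_rw [mul_div_assoc', div_mul_eq_mul_div, Finset.mul_sum, Finset.sum_mul]
  rw [← Finset.sum_div, ← Finset.sum_div]
  congr 1
  -- reindex the double sum along the involution `swapOn A`
  have h1 : ∑ x : (i : ι) → α i, ∑ y : (i : ι) → α i, g x * f (A.piecewise y x) =
      ∑ p : ((i : ι) → α i) × ((i : ι) → α i), g p.1 * f (A.piecewise p.2 p.1) := by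
    rw [Fintype.sum_prod_type]
  have h2 : ∑ x : (i : ι) → α i, ∑ y : (i : ι) → α i, g (A.piecewise y x) * f x =
      ∑ p : ((i : ι) → α i) × ((i : ι) → α i), g (A.piecewise p.2 p.1) * f p.1 := by
    rw [Fintype.sum_prod_type]
  rw [h1, h2, ← Equiv.sum_comp (swapOn A) (fun p => g (A.piecewise p.2 p.1) * f p.1)]
  refine Finset.sum_congr rfl fun p _ => ?_
  have e1 : A.piecewise (swapOn A p).2 (swapOn A p).1 = p.1 := by
    funext i
    by_cases hi : i ∈ A <;> simp [swapOn, Finset.piecewise, hi]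
  rw [e1]
  rfl

/-- The total sum is `E_A`-invariant: `∑_x (E_A f)(x) = ∑_x f(x)`. [cite: KellerLifshitzMarcus2023, §2.2] -/
theorem sum_condAvg [∀ i, Nonempty (α i)] (A : Finset ι) (f : ((i : ι) → α i) → ℝ) :
    ∑ x, condAvg A f x = ∑ x, f x := by
  have h := sum_mul_condAvg A f (fun _ => 1)
  have hc : condAvg A (fun _ : (i : ι) → α i => (1 : ℝ)) = fun _ => 1 :=
    DependsOff.condAvg_eq (fun _ _ _ => rfl)
  simp only [one_mul, hc] at h
  exact h

/-! ## Alternating sums over a Boolean lattice -/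

omit [Fintype ι] in
/-- **Pairing lemma**: an alternating sum over `T.powerset` vanishes when the summand is invariant under
inserting some fixed `i ∈ T`. [folklore] -/
private theorem sum_powerset_neg_one_pow_mul_eq_zero {T : Finset ι} {i : ι} (hi : i ∈ T) (Φ : Finset ι → ℝ)
    (hΦ : ∀ R, R ⊆ T.erase i → Φ (insert i R) = Φ R) :
    ∑ R ∈ T.powerset, (-1 : ℝ) ^ R.card * Φ R = 0 := by
  have hT : T = insert i (T.erase i) := (Finset.insert_erase hi).symm
  rw [hT, Finset.sum_powerset_insert (Finset.notMem_erase i T), ← Finset.sum_add_distrib]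
  refine Finset.sum_eq_zero fun R hR => ?_
  rw [Finset.mem_powerset] at hR
  have hiR : i ∉ R := fun h => Finset.notMem_erase i T (hR h)
  rw [Finset.card_insert_of_notMem hiR, pow_succ, hΦ R hR]
  ring

omit [Fintype ι] in
/-- Möbius identity on the Boolean lattice: `∑_{U ⊆ S} (-1)^{|U|} = [S = ∅]` (real form of Mathlib's
`Finset.sum_powerset_neg_one_pow_card`). [folklore] -/
private theorem sum_powerset_neg_one_pow_card_real (S : Finset ι) :
    ∑ U ∈ S.powerset, (-1 : ℝ) ^ U.card = if S = ∅ then 1 else 0 := by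
  split_ifs with hS
  · subst hS
    simp
  · exact_mod_cast Finset.sum_powerset_neg_one_pow_card_of_nonempty (Finset.nonempty_iff_ne_empty.2 hS)

/-! ## Efron–Stein parts -/

/-- **The Efron–Stein part** `f^{=T} := ∑_{R ⊆ T} (-1)^{|T|+|R|} E_{Rᶜ} f` (inclusion–exclusion form of the
decomposition `f = ∑_T f^{=T}`, `f^{=T}` depending only on `x_T` and averaging to zero in each coordinate
of `T`). [cite: KellerLifshitzMarcus2023, §2.2 (Efron–Stein decomposition)] -/
def esPart (T : Finset ι) (f : ((i : ι) → α i) → ℝ) (x : (i : ι) → α i) : ℝ :=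
  ∑ R ∈ T.powerset, (-1 : ℝ) ^ (T.card + R.card) * condAvg (univ \ R) f x

/-- Linearity of `f ↦ f^{=T}`: sums. [cite: KellerLifshitzMarcus2023, §2.2] -/
theorem esPart_add (T : Finset ι) (f g : ((i : ι) → α i) → ℝ) :
    esPart T (fun x => f x + g x) = fun x => esPart T f x + esPart T g x := by
  funext x
  simp only [esPart, condAvg_add, mul_add, Finset.sum_add_distrib]

/-- Linearity of `f ↦ f^{=T}`: scalars. [cite: KellerLifshitzMarcus2023, §2.2] -/
theorem esPart_smul (T : Finset ι) (c : ℝ) (f : ((i : ι) → α i) → ℝ) :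
    esPart T (fun x => c * f x) = fun x => c * esPart T f x := by
  funext x
  simp only [esPart, condAvg_smul, Finset.mul_sum]
  exact Finset.sum_congr rfl fun R _ => by ring

/-- [cite: KellerLifshitzMarcus2023, §2.2] -/
theorem esPart_sub (T : Finset ι) (f g : ((i : ι) → α i) → ℝ) :
    esPart T (fun x => f x - g x) = fun x => esPart T f x - esPart T g x := by
  funext x
  simp only [esPart, condAvg_sub, mul_sub, Finset.sum_sub_distrib]

/-- [cite: KellerLifshitzMarcus2023, §2.2] -/
theorem esPart_zero (T : Finset ι) : esPart T (fun _ : (i : ι) → α i => (0 : ℝ)) = fun _ => 0 := by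
  funext x; simp [esPart, condAvg_zero]

/-- `E_A` of a sum over the powerset (bookkeeping). [cite: KellerLifshitzMarcus2023, §2.2] -/
theorem esPart_finset_sum {κ : Type*} (s : Finset κ) (T : Finset ι) (F : κ → ((i : ι) → α i) → ℝ) :
    esPart T (fun x => ∑ k ∈ s, F k x) = fun x => ∑ k ∈ s, esPart T (F k) x := by
  funext x
  simp only [esPart, condAvg_finset_sum, Finset.mul_sum]
  rw [Finset.sum_comm]

/-- `E_A f^{=T} = (E_A f)^{=T}` (all averaging operators commute). [cite: KellerLifshitzMarcus2023, §2.2] -/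
theorem condAvg_esPart_comm [∀ i, Nonempty (α i)] (A T : Finset ι) (f : ((i : ι) → α i) → ℝ) :
    condAvg A (esPart T f) = esPart T (condAvg A f) := by
  funext x
  unfold esPart
  rw [show (fun x => ∑ R ∈ T.powerset, (-1 : ℝ) ^ (T.card + R.card) * condAvg (univ \ R) f x) =
      fun x => ∑ R ∈ T.powerset, (fun x => (-1 : ℝ) ^ (T.card + R.card) * condAvg (univ \ R) f x) x
    from rfl, condAvg_finset_sum]
  refine Finset.sum_congr rfl fun R _ => ?_
  rw [condAvg_smul]
  simp only
  rw [condAvg_comm]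

/-- **`E_A` kills the parts it meets**: if `i ∈ A ∩ T` then `E_A f^{=T} = 0`.
[cite: KellerLifshitzMarcus2023, §2.2 (`E_S f = ∑_{T ⊆ Sᶜ} f^{=T}`)] -/
theorem condAvg_esPart_eq_zero [∀ i, Nonempty (α i)] {A T : Finset ι} {i : ι} (hiA : i ∈ A) (hiT : i ∈ T)
    (f : ((i : ι) → α i) → ℝ) : condAvg A (esPart T f) = fun _ => 0 := by
  funext x
  rw [condAvg_esPart_comm]
  unfold esPart
  simp_rw [condAvg_condAvg]
  -- `(-1)^{|T|+|R|} = (-1)^{|T|} (-1)^{|R|}`; the map `R ↦ E_{(univ \ R) ∪ A} f x` is insert-`i`-invariant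
  have key := sum_powerset_neg_one_pow_mul_eq_zero hiT (fun R => condAvg (univ \ R ∪ A) f x) ?_
  · calc ∑ R ∈ T.powerset, (-1 : ℝ) ^ (T.card + R.card) * condAvg (univ \ R ∪ A) f x
        = (-1 : ℝ) ^ T.card * ∑ R ∈ T.powerset, (-1 : ℝ) ^ R.card * condAvg (univ \ R ∪ A) f x := by
          rw [Finset.mul_sum]
          exact Finset.sum_congr rfl fun R _ => by rw [pow_add]; ring
      _ = 0 := by rw [key, mul_zero]
  · intro R _
    congr 1
    ext j
    simp only [Finset.mem_union, Finset.mem_sdiff, Finset.mem_univ, true_and, Finset.mem_insert, not_or]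
    constructor
    · rintro (⟨-, hjR⟩ | hjA)
      · exact Or.inl hjR
      · exact Or.inr hjA
    · rintro (hjR | hjA)
      · by_cases hji : j = i
        · exact Or.inr (hji ▸ hiA)
        · exact Or.inl ⟨hji, hjR⟩
      · exact Or.inr hjA

/-- `f^{=T}` does not depend on the coordinates outside `T`. [cite: KellerLifshitzMarcus2023, §2.2] -/
theorem dependsOff_esPart (T : Finset ι) (f : ((i : ι) → α i) → ℝ) : DependsOff (univ \ T) (esPart T f) := by
  intro x x' h
  unfold esPart
  refine Finset.sum_congr rfl fun R hR => ?_
  rw [Finset.mem_powerset] at hR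
  congr 1
  exact dependsOff_condAvg (univ \ R) f x x' fun i hi => h i fun hi' => hi (by
    rw [Finset.mem_sdiff] at hi' ⊢
    exact ⟨hi'.1, fun hR' => hi'.2 (hR hR')⟩)

/-- **`E_A` fixes the parts it misses**: if `A ∩ T = ∅` then `E_A f^{=T} = f^{=T}`.
[cite: KellerLifshitzMarcus2023, §2.2] -/
theorem condAvg_esPart_of_disjoint [∀ i, Nonempty (α i)] {A T : Finset ι} (h : Disjoint A T)
    (f : ((i : ι) → α i) → ℝ) : condAvg A (esPart T f) = esPart T f :=
  ((dependsOff_esPart T f).mono (by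
    intro i hi
    rw [Finset.mem_sdiff]
    exact ⟨Finset.mem_univ _, fun hiT => Finset.disjoint_left.1 h hi hiT⟩)).condAvg_eq

/-- **`(E_A f)^{=T} = [A ∩ T = ∅] · f^{=T}`** (KLM §2.2, item 2: `E_S f = ∑_{T ⊆ Sᶜ} f^{=T}`).
[cite: KellerLifshitzMarcus2023, §2.2 (item 2)] -/
theorem esPart_condAvg [∀ i, Nonempty (α i)] (A T : Finset ι) (f : ((i : ι) → α i) → ℝ) :
    esPart T (condAvg A f) = if Disjoint A T then esPart T f else fun _ => 0 := by
  rw [← condAvg_esPart_comm]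
  split_ifs with h
  · exact condAvg_esPart_of_disjoint h f
  · obtain ⟨i, hiA, hiT⟩ : ∃ i, i ∈ A ∧ i ∈ T := by
      rw [Finset.not_disjoint_iff] at h
      exact h
    exact condAvg_esPart_eq_zero hiA hiT f

/-- Exchange of a double sum over `{(T, R) : R ⊆ T}`. [folklore] -/
private theorem sum_sum_powerset_comm {M : Type*} [AddCommMonoid M] (a : Finset ι → Finset ι → M) :
    ∑ T : Finset ι, ∑ R ∈ T.powerset, a T R =
      ∑ R : Finset ι, ∑ U ∈ (univ \ R).powerset, a (R ∪ U) R := by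
  classical
  -- both sides are the sum over pairs `R ⊆ T`, the right one parametrised by `U = T \ R`
  have hL : ∑ T : Finset ι, ∑ R ∈ T.powerset, a T R =
      ∑ T : Finset ι, ∑ R : Finset ι, if R ⊆ T then a T R else 0 := by
    refine Finset.sum_congr rfl fun T _ => ?_
    rw [← Finset.sum_filter]
    congr 1
    ext R
    simp
  have hR : ∑ R : Finset ι, ∑ U ∈ (univ \ R).powerset, a (R ∪ U) R =
      ∑ R : Finset ι, ∑ T : Finset ι, if R ⊆ T then a T R else 0 := by
    refine Finset.sum_congr rfl fun R _ => ?_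
    rw [← Finset.sum_filter]
    -- reindex `U ↦ R ∪ U`, a bijection from `(univ \ R).powerset` onto `{T : R ⊆ T}`
    refine Finset.sum_nbij' (fun U => R ∪ U) (fun T => T \ R) ?_ ?_ ?_ ?_ ?_
    · intro U hU
      simp only [Finset.mem_filter, Finset.mem_univ, true_and]
      exact Finset.subset_union_left
    · intro T hT
      simp only [Finset.mem_powerset]
      exact Finset.sdiff_subset_sdiff (Finset.subset_univ _) le_rfl
    · intro U hU
      rw [Finset.mem_powerset] at hU
      rw [Finset.union_sdiff_left]
      ext j
      simp only [Finset.mem_sdiff]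
      constructor
      · exact fun h => h.1
      · intro hj
        exact ⟨hj, fun hjR => by
          have := hU hj
          rw [Finset.mem_sdiff] at this
          exact this.2 hjR⟩
    · intro T hT
      simp only [Finset.mem_filter, Finset.mem_univ, true_and] at hT
      exact Finset.union_sdiff_of_subset hT
    · intro U hU
      rfl
  rw [hL, hR, Finset.sum_comm]

/-- **Efron–Stein decomposition**: `∑_T f^{=T} = f`. [cite: KellerLifshitzMarcus2023, §2.2 ("`f = ∑_{S ⊆ [n]} f^{=S}`")] -/
theorem sum_esPart [∀ i, Nonempty (α i)] (f : ((i : ι) → α i) → ℝ) (x : (i : ι) → α i) :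
    ∑ T : Finset ι, esPart T f x = f x := by
  unfold esPart
  rw [sum_sum_powerset_comm (fun T R => (-1 : ℝ) ^ (T.card + R.card) * condAvg (univ \ R) f x)]
  -- inner sum: `∑_{U ⊆ Rᶜ} (-1)^{|R ∪ U| + |R|} = ∑_{U ⊆ Rᶜ} (-1)^{|U|} = [Rᶜ = ∅]`
  have inner : ∀ R : Finset ι, ∑ U ∈ (univ \ R).powerset,
      (-1 : ℝ) ^ ((R ∪ U).card + R.card) * condAvg (univ \ R) f x =
        (if univ \ R = ∅ then 1 else 0) * condAvg (univ \ R) f x := by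
    intro R
    rw [← Finset.sum_mul, ← sum_powerset_neg_one_pow_card_real]
    congr 1
    refine Finset.sum_congr rfl fun U hU => ?_
    rw [Finset.mem_powerset] at hU
    have hdisj : Disjoint R U := by
      rw [Finset.disjoint_left]
      intro j hjR hjU
      have := hU hjU
      rw [Finset.mem_sdiff] at this
      exact this.2 hjR
    rw [Finset.card_union_of_disjoint hdisj, show R.card + U.card + R.card = U.card + 2 * R.card by ring,
      pow_add, pow_mul]
    norm_num
  simp_rw [inner]
  simp_rw [Finset.sdiff_eq_empty_iff_subset, Finset.univ_subset_iff, ite_mul, one_mul, zero_mul]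
  rw [Finset.sum_ite_eq' univ (univ : Finset ι)]
  simp only [Finset.mem_univ, if_true, Finset.sdiff_self]
  rw [show (∅ : Finset ι) = ∅ from rfl, condAvg_empty]

/-- `E_A f = ∑_{T ∩ A = ∅} f^{=T}` (KLM §2.2 item 2). [cite: KellerLifshitzMarcus2023, §2.2 (item 2)] -/
theorem condAvg_eq_sum_esPart [∀ i, Nonempty (α i)] (A : Finset ι) (f : ((i : ι) → α i) → ℝ)
    (x : (i : ι) → α i) :
    condAvg A f x = ∑ T : Finset ι, if Disjoint A T then esPart T f x else 0 := by
  conv_lhs => rw [← sum_esPart (condAvg A f) x]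
  refine Finset.sum_congr rfl fun T _ => ?_
  rw [esPart_condAvg]
  split_ifs <;> rfl

/-- **Orthogonality of the Efron–Stein parts**: `∑_x f^{=T}(x) g^{=T'}(x) = 0` for `T ≠ T'`.
[cite: KellerLifshitzMarcus2023, §2.2 ("the spaces `V^{=T}` are pairwise orthogonal")] -/
theorem sum_esPart_mul_esPart [∀ i, Nonempty (α i)] {T T' : Finset ι} (hTT' : T ≠ T')
    (f g : ((i : ι) → α i) → ℝ) : ∑ x, esPart T f x * esPart T' g x = 0 := by
  -- a coordinate in the symmetric difference: say `i ∈ T \ T'` (or swap)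
  have key : ∀ {T T' : Finset ι} (f g : ((i : ι) → α i) → ℝ) {i : ι}, i ∈ T → i ∉ T' →
      ∑ x, esPart T f x * esPart T' g x = 0 := by
    intro T T' f g i hiT hiT'
    -- `g^{=T'}` is `E_i`-invariant, `E_i f^{=T} = 0`, and `E_i` is self-adjoint
    have h1 : condAvg {i} (esPart T' g) = esPart T' g :=
      condAvg_esPart_of_disjoint (Finset.disjoint_singleton_left.2 hiT') g
    have h2 : condAvg {i} (esPart T f) = fun _ => 0 :=
      condAvg_esPart_eq_zero (Finset.mem_singleton_self i) hiT f
    calc ∑ x, esPart T f x * esPart T' g x = ∑ x, esPart T f x * condAvg {i} (esPart T' g) x := by rw [h1]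
      _ = ∑ x, condAvg {i} (esPart T f) x * esPart T' g x := sum_mul_condAvg {i} _ _
      _ = 0 := by rw [h2]; simp
  by_cases h : ∃ i ∈ T, i ∉ T'
  · obtain ⟨i, hiT, hiT'⟩ := h
    exact key f g hiT hiT'
  · push Not at h
    -- then `T ⊆ T'`, so some `i ∈ T' \ T`
    have hsub : T ⊆ T' := fun i hi => h i hi
    obtain ⟨i, hiT', hiT⟩ : ∃ i ∈ T', i ∉ T := by
      by_contra hc
      push Not at hc
      exact hTT' (Finset.Subset.antisymm hsub fun i hi => hc i hi)
    simp_rw [mul_comm (esPart T f _)]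
    exact key g f hiT' hiT

/-- **The parts of a part**: `(f^{=T})^{=T'} = [T = T'] f^{=T}` (so `f ↦ f^{=T}` is the projection onto
`V^{=T}`). [cite: KellerLifshitzMarcus2023, §2.2] -/
theorem esPart_esPart [∀ i, Nonempty (α i)] (T T' : Finset ι) (f : ((i : ι) → α i) → ℝ) :
    esPart T' (esPart T f) = if T = T' then esPart T f else fun _ => 0 := by
  -- `(f^{=T})^{=T'} = ∑_{R ⊆ T'} ± E_{Rᶜ} f^{=T}` and `E_{Rᶜ} f^{=T} = [T ⊆ R] f^{=T}`
  funext x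
  unfold esPart
  have hE : ∀ R : Finset ι, condAvg (univ \ R) (esPart T f) x = if T ⊆ R then esPart T f x else 0 := by
    intro R
    split_ifs with hTR
    · rw [condAvg_esPart_of_disjoint]
      exact Finset.disjoint_left.2 fun i hi hiT => (Finset.mem_sdiff.1 hi).2 (hTR hiT)
    · obtain ⟨i, hiT, hiR⟩ : ∃ i ∈ T, i ∉ R := by
        by_contra hc; push Not at hc; exact hTR fun i hi => hc i hi
      rw [condAvg_esPart_eq_zero (A := univ \ R) (by simp [hiR]) hiT]
  change ∑ R ∈ T'.powerset, (-1 : ℝ) ^ (T'.card + R.card) * condAvg (univ \ R) (esPart T f) x = _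
  simp_rw [hE]
  split_ifs with hTT'
  · subst hTT'
    -- only `R = T` survives
    rw [Finset.sum_eq_single T]
    · simp [← two_mul, pow_mul]
      rfl
    · intro R hR hRT
      rw [Finset.mem_powerset] at hR
      have : ¬ T ⊆ R := fun h => hRT (Finset.Subset.antisymm hR h)
      simp [this]
    · intro h; exact absurd (Finset.mem_powerset.2 le_rfl) h
  · change _ = (0 : ℝ)
    by_cases hTT'sub : T ⊆ T'
    · -- alternating sum over `{R : T ⊆ R ⊆ T'}` with `T ≠ T'` vanishes: pick `i ∈ T' \ T`
      obtain ⟨i, hiT', hiT⟩ : ∃ i ∈ T', i ∉ T := by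
        by_contra hc; push Not at hc
        exact hTT' (Finset.Subset.antisymm hTT'sub fun j hj => hc j hj)
      have key := sum_powerset_neg_one_pow_mul_eq_zero hiT'
        (fun R => if T ⊆ R then esPart T f x else 0) ?_
      · calc ∑ R ∈ T'.powerset, (-1 : ℝ) ^ (T'.card + R.card) * (if T ⊆ R then esPart T f x else 0)
            = (-1 : ℝ) ^ T'.card *
                ∑ R ∈ T'.powerset, (-1 : ℝ) ^ R.card * (if T ⊆ R then esPart T f x else 0) := by
              rw [Finset.mul_sum]
              exact Finset.sum_congr rfl fun R _ => by rw [pow_add]; ring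
          _ = 0 := by rw [key, mul_zero]
      · intro R _
        have : T ⊆ insert i R ↔ T ⊆ R := by
          constructor
          · intro h j hj
            have := h hj
            rw [Finset.mem_insert] at this
            rcases this with rfl | h'
            · exact absurd hj hiT
            · exact h'
          · exact fun h => h.trans (Finset.subset_insert i R)
        simp only [this]
    · refine Finset.sum_eq_zero fun R hR => ?_
      rw [Finset.mem_powerset] at hR
      have : ¬ T ⊆ R := fun h => hTT'sub (h.trans hR)
      simp [this]

/-! ## Laplacians -/

/-- **The Laplacian** `L_S f := ∑_{R ⊆ S} (-1)^{|R|} E_R f` (`= Π_{i∈S} (I - E_i) f`; KLM §2.2: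
`L_S f = ∑_{T ⊇ S} f^{=T}`). [cite: KellerLifshitzMarcus2023, §2.2 (the Laplacians `L_S`)] -/
def lap (S : Finset ι) (f : ((i : ι) → α i) → ℝ) (x : (i : ι) → α i) : ℝ :=
  ∑ R ∈ S.powerset, (-1 : ℝ) ^ R.card * condAvg R f x

/-- **`(L_S f)^{=T} = [S ⊆ T] f^{=T}`**, i.e. `L_S f = ∑_{T ⊇ S} f^{=T}`.
[cite: KellerLifshitzMarcus2023, §2.2 (item 2, `L_S f = ∑_{T ⊇ S} f^{=T}`)] -/
theorem esPart_lap [∀ i, Nonempty (α i)] (S T : Finset ι) (f : ((i : ι) → α i) → ℝ) :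
    esPart T (lap S f) = if S ⊆ T then esPart T f else fun _ => 0 := by
  funext x
  unfold lap
  rw [show (fun x => ∑ R ∈ S.powerset, (-1 : ℝ) ^ R.card * condAvg R f x) =
      fun x => ∑ R ∈ S.powerset, (fun x => (-1 : ℝ) ^ R.card * condAvg R f x) x from rfl,
    esPart_finset_sum]
  simp only
  have hterm : ∀ R : Finset ι, esPart T (fun x => (-1 : ℝ) ^ R.card * condAvg R f x) x =
      (-1 : ℝ) ^ R.card * (if Disjoint R T then esPart T f x else 0) := by
    intro R
    rw [esPart_smul]
    simp only
    rw [esPart_condAvg]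
    split_ifs <;> rfl
  simp_rw [hterm]
  -- `∑_{R ⊆ S} (-1)^{|R|} [R ∩ T = ∅] = ∑_{R ⊆ S \ T} (-1)^{|R|} = [S \ T = ∅] = [S ⊆ T]`
  have hsum : ∑ R ∈ S.powerset, (-1 : ℝ) ^ R.card * (if Disjoint R T then esPart T f x else 0) =
      (∑ R ∈ (S \ T).powerset, (-1 : ℝ) ^ R.card) * esPart T f x := by
    rw [Finset.sum_mul]
    simp_rw [mul_ite, mul_zero]
    rw [← Finset.sum_filter]
    congr 1
    ext R
    simp only [Finset.mem_filter, Finset.mem_powerset, Finset.subset_sdiff, and_comm, disjoint_comm]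
  rw [hsum, sum_powerset_neg_one_pow_card_real]
  by_cases h : S ⊆ T
  · rw [if_pos (Finset.sdiff_eq_empty_iff_subset.2 h), if_pos h, one_mul]
  · rw [if_neg (fun h' => h (Finset.sdiff_eq_empty_iff_subset.1 h')), if_neg h, zero_mul]

/-- `L_∅ = id`. [cite: KellerLifshitzMarcus2023, §2.2] -/
theorem lap_empty [∀ i, Nonempty (α i)] (f : ((i : ι) → α i) → ℝ) : lap ∅ f = f := by
  funext x
  simp [lap, condAvg_empty]

/-- `L_{i} f = f - E_i f`. [cite: KellerLifshitzMarcus2023, §2.2] -/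
theorem lap_singleton [∀ i, Nonempty (α i)] (i : ι) (f : ((i : ι) → α i) → ℝ) :
    lap {i} f = fun x => f x - condAvg {i} f x := by
  funext x
  rw [lap, show ({i} : Finset ι) = insert i ∅ from rfl, Finset.sum_powerset_insert (Finset.notMem_empty i),
    Finset.powerset_empty, Finset.sum_singleton, Finset.sum_singleton, Finset.card_empty, pow_zero, one_mul,
    condAvg_empty, show insert i (∅ : Finset ι) = {i} from rfl, Finset.card_singleton, pow_one]
  ring

/-- Two functions with the same Efron–Stein parts are equal. [cite: KellerLifshitzMarcus2023, §2.2] -/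
theorem eq_of_esPart_eq [∀ i, Nonempty (α i)] {f g : ((i : ι) → α i) → ℝ}
    (h : ∀ T : Finset ι, esPart T f = esPart T g) : f = g := by
  funext x
  rw [← sum_esPart f x, ← sum_esPart g x]
  exact Finset.sum_congr rfl fun T _ => by rw [h T]

/-- Linearity of `L_S`. [cite: KellerLifshitzMarcus2023, §2.2] -/
theorem lap_add (S : Finset ι) (f g : ((i : ι) → α i) → ℝ) :
    lap S (fun x => f x + g x) = fun x => lap S f x + lap S g x := by
  funext x; simp only [lap, condAvg_add, mul_add, Finset.sum_add_distrib]

/-- [cite: KellerLifshitzMarcus2023, §2.2] -/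
theorem lap_smul (S : Finset ι) (c : ℝ) (f : ((i : ι) → α i) → ℝ) :
    lap S (fun x => c * f x) = fun x => c * lap S f x := by
  funext x; simp only [lap, condAvg_smul, Finset.mul_sum]; exact Finset.sum_congr rfl fun R _ => by ring

/-- `L_S` of a part: `L_S f^{=T} = [S ⊆ T] f^{=T}`. [cite: KellerLifshitzMarcus2023, §2.2] -/
theorem lap_esPart [∀ i, Nonempty (α i)] (S T : Finset ι) (f : ((i : ι) → α i) → ℝ) :
    lap S (esPart T f) = if S ⊆ T then esPart T f else fun _ => 0 := by
  apply eq_of_esPart_eq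
  intro T'
  rw [esPart_lap, esPart_esPart]
  by_cases hTT' : T = T'
  · subst hTT'
    by_cases hS : S ⊆ T
    · rw [if_pos hS, if_pos rfl, if_pos hS, esPart_esPart, if_pos rfl]
    · rw [if_neg hS, if_neg hS, esPart_zero]
  · rw [if_neg hTT', ite_self]
    by_cases hS : S ⊆ T
    · rw [if_pos hS, esPart_esPart, if_neg hTT']
    · rw [if_neg hS, esPart_zero]

/-- `L_S L_{S'} = L_{S ∪ S'}`. [cite: KellerLifshitzMarcus2023, §2.2] -/
theorem lap_lap [∀ i, Nonempty (α i)] (S S' : Finset ι) (f : ((i : ι) → α i) → ℝ) :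
    lap S (lap S' f) = lap (S ∪ S') f := by
  apply eq_of_esPart_eq
  intro T
  rw [esPart_lap, esPart_lap]
  by_cases hS : S ⊆ T
  · rw [if_pos hS, esPart_lap]
    by_cases hS' : S' ⊆ T
    · rw [if_pos hS', if_pos (Finset.union_subset hS hS')]
    · rw [if_neg hS', if_neg (fun h => hS' (Finset.union_subset_iff.1 h).2)]
  · rw [if_neg hS, esPart_lap, if_neg (fun h => hS (Finset.union_subset_iff.1 h).1)]

/-- `E_A L_S f = L_S E_A f`. [cite: KellerLifshitzMarcus2023, §2.2] -/
theorem condAvg_lap_comm [∀ i, Nonempty (α i)] (A S : Finset ι) (f : ((i : ι) → α i) → ℝ) :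
    condAvg A (lap S f) = lap S (condAvg A f) := by
  apply eq_of_esPart_eq
  intro T
  rw [esPart_condAvg, esPart_lap, esPart_lap, esPart_condAvg]
  by_cases h1 : Disjoint A T <;> by_cases h2 : S ⊆ T <;> simp only [h1, h2, if_true, if_false]

/-- If `i ∈ A ∩ S` then `E_A L_S f = 0`. [cite: KellerLifshitzMarcus2023, §2.2] -/
theorem condAvg_lap_eq_zero [∀ i, Nonempty (α i)] {A S : Finset ι} {i : ι} (hiA : i ∈ A) (hiS : i ∈ S)
    (f : ((i : ι) → α i) → ℝ) : condAvg A (lap S f) = fun _ => 0 := by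
  apply eq_of_esPart_eq
  intro T
  rw [esPart_condAvg, esPart_zero]
  split_ifs with h
  · rw [esPart_lap]
    split_ifs with h'
    · exact absurd (h' hiS) (Finset.disjoint_left.1 h hiA)
    · rfl
  · rfl

/-- `L_S f` does not depend on `B` if `f` does not. [cite: KellerLifshitzMarcus2023, §2.2] -/
theorem dependsOff_lap {B : Finset ι} {f : ((i : ι) → α i) → ℝ} (h : DependsOff B f) (S : Finset ι) :
    DependsOff B (lap S f) := by
  intro x x' hxx'
  unfold ProductSpace.lap
  refine Finset.sum_congr rfl fun R _ => ?_
  congr 1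
  exact dependsOff_condAvg_of_sdiff (h.mono Finset.sdiff_subset) x x' hxx'

/-! ## The noise operator on a set of coordinates -/

/-- **Noise on the coordinate set `A`**: `T_{ρ,A} f := ∑_T ρ^{|T ∩ A|} f^{=T}` (for `A = univ` this is the noise
operator `T_ρ f = ∑_S ρ^{|S|} f^{=S}` of KLM eq. (2.1); in general it is the tensor product of `T_ρ` on the
coordinates in `A` with the identity elsewhere). [cite: KellerLifshitzMarcus2023, §2.2 (eq. (2.1))] -/
def noiseOn (ρ : ℝ) (A : Finset ι) (f : ((i : ι) → α i) → ℝ) (x : (i : ι) → α i) : ℝ :=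
  ∑ T : Finset ι, ρ ^ (T ∩ A).card * esPart T f x

/-- `(T_{ρ,A} f)^{=T} = ρ^{|T∩A|} f^{=T}`. [cite: KellerLifshitzMarcus2023, §2.2 (eq. (2.1))] -/
theorem esPart_noiseOn [∀ i, Nonempty (α i)] (ρ : ℝ) (A T : Finset ι) (f : ((i : ι) → α i) → ℝ) :
    esPart T (noiseOn ρ A f) = fun x => ρ ^ (T ∩ A).card * esPart T f x := by
  unfold noiseOn
  rw [show (fun x => ∑ T' : Finset ι, ρ ^ (T' ∩ A).card * esPart T' f x) =
      fun x => ∑ T' ∈ (univ : Finset (Finset ι)), (fun x => ρ ^ (T' ∩ A).card * esPart T' f x) x from rfl,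
    esPart_finset_sum]
  funext x
  rw [Finset.sum_eq_single T]
  · rw [esPart_smul]
    show ρ ^ (T ∩ A).card * esPart T (esPart T f) x = _
    rw [esPart_esPart, if_pos rfl]
  · intro T' _ hT'T
    rw [esPart_smul]
    show ρ ^ (T' ∩ A).card * esPart T (esPart T' f) x = 0
    rw [esPart_esPart, if_neg hT'T]
    simp
  · intro h; exact absurd (Finset.mem_univ T) h

/-- `T_{1,A} = id`. [cite: KellerLifshitzMarcus2023, §2.2] -/
theorem noiseOn_one [∀ i, Nonempty (α i)] (A : Finset ι) (f : ((i : ι) → α i) → ℝ) : noiseOn 1 A f = f := by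
  funext x
  simp [noiseOn, sum_esPart]

/-- `T_{ρ,∅} = id`. [cite: KellerLifshitzMarcus2023, §2.2] -/
theorem noiseOn_empty [∀ i, Nonempty (α i)] (ρ : ℝ) (f : ((i : ι) → α i) → ℝ) : noiseOn ρ ∅ f = f := by
  funext x
  simp [noiseOn, sum_esPart]

/-- **Semigroup law**: `T_{ρ,A} T_{σ,A} = T_{ρσ,A}`. [cite: KellerLifshitzMarcus2023, §2.2 ("`T_ρ` is multiplicative")] -/
theorem noiseOn_noiseOn [∀ i, Nonempty (α i)] (ρ σ : ℝ) (A : Finset ι) (f : ((i : ι) → α i) → ℝ) :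
    noiseOn ρ A (noiseOn σ A f) = noiseOn (ρ * σ) A f := by
  apply eq_of_esPart_eq
  intro T
  rw [esPart_noiseOn, esPart_noiseOn, esPart_noiseOn]
  funext x
  simp only [mul_pow]
  ring

/-- Noise on disjoint coordinate sets composes: `T_{ρ,A} T_{ρ,B} = T_{ρ,A∪B}` for `A ∩ B = ∅`.
[cite: KellerLifshitzMarcus2023, §2.2 (tensor structure of `T_ρ`)] -/
theorem noiseOn_noiseOn_of_disjoint [∀ i, Nonempty (α i)] (ρ : ℝ) {A B : Finset ι} (hAB : Disjoint A B)
    (f : ((i : ι) → α i) → ℝ) : noiseOn ρ A (noiseOn ρ B f) = noiseOn ρ (A ∪ B) f := by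
  apply eq_of_esPart_eq
  intro T
  rw [esPart_noiseOn, esPart_noiseOn, esPart_noiseOn]
  funext x
  rw [← mul_assoc, ← pow_add, Finset.inter_union_distrib_left,
    Finset.card_union_of_disjoint (hAB.mono Finset.inter_subset_right Finset.inter_subset_right)]

/-- Noise on coordinates the function does not depend on does nothing.
[cite: KellerLifshitzMarcus2023, §2.2] -/
theorem noiseOn_of_dependsOff [∀ i, Nonempty (α i)] (ρ : ℝ) {A : Finset ι} {f : ((i : ι) → α i) → ℝ}
    (h : DependsOff A f) : noiseOn ρ A f = f := by
  apply eq_of_esPart_eq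
  intro T
  rw [esPart_noiseOn]
  by_cases hT : Disjoint A T
  · funext x
    rw [show T ∩ A = ∅ from Finset.disjoint_iff_inter_eq_empty.1 (disjoint_comm.1 hT)]
    simp
  · -- `f^{=T} = (E_A f)^{=T} = 0`
    have : esPart T f = fun _ => 0 := by
      rw [← h.condAvg_eq, esPart_condAvg, if_neg hT]
    funext x
    rw [this]
    simp

/-- **One coordinate**: `T_{ρ,{i}} f = E_i f + ρ (f - E_i f) = E_i f + ρ L_i f`.
[cite: KellerLifshitzMarcus2023, §3.2.3 ("`T_ρ^{(i)} : f ↦ E_i[f] + ρ L_i[f]`")] -/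
theorem noiseOn_singleton [∀ i, Nonempty (α i)] (ρ : ℝ) (i : ι) (f : ((i : ι) → α i) → ℝ) :
    noiseOn ρ {i} f = fun x => condAvg {i} f x + ρ * lap {i} f x := by
  apply eq_of_esPart_eq
  intro T
  rw [esPart_noiseOn, esPart_add, esPart_condAvg, esPart_smul, esPart_lap]
  funext x
  by_cases hi : i ∈ T
  · rw [show T ∩ {i} = {i} from Finset.inter_singleton_of_mem hi, Finset.card_singleton, pow_one,
      if_neg (by simp [hi]), if_pos (by simp [hi])]
    simp
  · rw [show T ∩ {i} = ∅ from Finset.inter_singleton_of_notMem hi, Finset.card_empty, pow_zero,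
      if_pos (by simp [hi]), if_neg (by simp [hi])]
    simp

/-- **Product form**: `T_{ρ, insert i A} = T_{ρ,A} ∘ (E_i + ρ L_i)` for `i ∉ A`.
[cite: KellerLifshitzMarcus2023, §3.2.3 ("we may write `T_ρ` as the composition of the operators `T_ρ^{(i)}`")] -/
theorem noiseOn_insert [∀ i, Nonempty (α i)] (ρ : ℝ) {i : ι} {A : Finset ι} (hi : i ∉ A)
    (f : ((i : ι) → α i) → ℝ) :
    noiseOn ρ (insert i A) f = noiseOn ρ A (fun x => condAvg {i} f x + ρ * lap {i} f x) := by
  rw [← noiseOn_singleton, noiseOn_noiseOn_of_disjoint ρ (Finset.disjoint_singleton_right.2 hi),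
    Finset.union_comm]
  rfl

/-- `T_{ρ,A}` commutes with every `E_B`. [cite: KellerLifshitzMarcus2023, Lemma 2.2] -/
theorem condAvg_noiseOn_comm [∀ i, Nonempty (α i)] (ρ : ℝ) (A B : Finset ι) (f : ((i : ι) → α i) → ℝ) :
    condAvg B (noiseOn ρ A f) = noiseOn ρ A (condAvg B f) := by
  apply eq_of_esPart_eq
  intro T
  rw [esPart_condAvg, esPart_noiseOn, esPart_noiseOn, esPart_condAvg]
  split_ifs <;> simp

/-- **`L_S T_ρ = T_ρ L_S`** (KLM Lemma 2.2, first identity). [cite: KellerLifshitzMarcus2023, Lemma 2.2] -/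
theorem lap_noiseOn_comm [∀ i, Nonempty (α i)] (ρ : ℝ) (A S : Finset ι) (f : ((i : ι) → α i) → ℝ) :
    lap S (noiseOn ρ A f) = noiseOn ρ A (lap S f) := by
  apply eq_of_esPart_eq
  intro T
  rw [esPart_lap, esPart_noiseOn, esPart_noiseOn, esPart_lap]
  split_ifs <;> simp

/-- Linearity of `T_{ρ,A}`. [cite: KellerLifshitzMarcus2023, §2.2] -/
theorem noiseOn_add [∀ i, Nonempty (α i)] (ρ : ℝ) (A : Finset ι) (f g : ((i : ι) → α i) → ℝ) :
    noiseOn ρ A (fun x => f x + g x) = fun x => noiseOn ρ A f x + noiseOn ρ A g x := by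
  funext x
  simp only [noiseOn, esPart_add, mul_add, Finset.sum_add_distrib]

/-- [cite: KellerLifshitzMarcus2023, §2.2] -/
theorem noiseOn_smul [∀ i, Nonempty (α i)] (ρ : ℝ) (A : Finset ι) (c : ℝ) (f : ((i : ι) → α i) → ℝ) :
    noiseOn ρ A (fun x => c * f x) = fun x => c * noiseOn ρ A f x := by
  funext x
  simp only [noiseOn, esPart_smul, Finset.mul_sum]
  exact Finset.sum_congr rfl fun T _ => by ring

/-- `T_{ρ,A} f` does not depend on `B` if `f` does not. [cite: KellerLifshitzMarcus2023, §2.2] -/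
theorem dependsOff_noiseOn [∀ i, Nonempty (α i)] {B : Finset ι} {f : ((i : ι) → α i) → ℝ}
    (h : DependsOff B f) (ρ : ℝ) (A : Finset ι) : DependsOff B (noiseOn ρ A f) := by
  -- `E_B (T f) = T (E_B f) = T f`, and `E_B g = g` characterises `DependsOff B` for averages
  have h1 : condAvg B (noiseOn ρ A f) = noiseOn ρ A f := by
    rw [condAvg_noiseOn_comm, h.condAvg_eq]
  intro x x' hxx'
  rw [← h1]
  exact dependsOff_condAvg B _ x x' hxx'

/-! ## Restrictions and derivatives -/

/-- **Restriction** `f_{S→y}`: the coordinates in `S` are frozen to `y` (as a function on all of `X`,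
constant in the `S`-coordinates). [cite: KellerLifshitzMarcus2023, §2.2 ("the restriction `f_{S→x}`")] -/
def restr (S : Finset ι) (y : (i : ι) → α i) (f : ((i : ι) → α i) → ℝ) (x : (i : ι) → α i) : ℝ :=
  f (S.piecewise y x)

/-- **Derivative** `D_{S,y} f := (L_S f)_{S→y}`. [cite: KellerLifshitzMarcus2023, §2.2 ("`D_{S,x} f = (L_S f)_{S→x}`")] -/
def deriv (S : Finset ι) (y : (i : ι) → α i) (f : ((i : ι) → α i) → ℝ) : ((i : ι) → α i) → ℝ :=
  restr S y (lap S f)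

omit [Fintype ι] [∀ i, Fintype (α i)] in
/-- `f_{∅→y} = f`. [cite: KellerLifshitzMarcus2023, §2.2] -/
theorem restr_empty (y : (i : ι) → α i) (f : ((i : ι) → α i) → ℝ) : restr ∅ y f = f := by
  funext x; simp [restr]

omit [Fintype ι] [∀ i, Fintype (α i)] in
/-- `f_{S→y}` does not depend on the `S`-coordinates. [cite: KellerLifshitzMarcus2023, §2.2] -/
theorem dependsOff_restr (S : Finset ι) (y : (i : ι) → α i) (f : ((i : ι) → α i) → ℝ) :
    DependsOff S (restr S y f) := by
  intro x x' hxx'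
  unfold restr
  congr 1
  funext i
  by_cases hi : i ∈ S <;> simp [Finset.piecewise, hi, hxx']

/-- `D_{S,y} f` does not depend on the `S`-coordinates. [cite: KellerLifshitzMarcus2023, §2.2] -/
theorem dependsOff_deriv (S : Finset ι) (y : (i : ι) → α i) (f : ((i : ι) → α i) → ℝ) :
    DependsOff S (deriv S y f) :=
  dependsOff_restr S y _

omit [Fintype ι] [∀ i, Fintype (α i)] in
/-- Restriction preserves "does not depend on `B`". [cite: KellerLifshitzMarcus2023, §2.2] -/
theorem dependsOff_restr_of {B : Finset ι} {f : ((i : ι) → α i) → ℝ} (h : DependsOff B f) (S : Finset ι)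
    (y : (i : ι) → α i) : DependsOff B (restr S y f) := by
  intro x x' hxx'
  unfold ProductSpace.restr
  exact h _ _ fun i hi => by by_cases hiS : i ∈ S <;> simp [Finset.piecewise, hiS, hxx' i hi]

/-- **Restriction on `S` commutes with averaging over coordinates disjoint from `S`.**
[cite: KellerLifshitzMarcus2023, §3.2.3 ("the restriction operator commutes with `T^{(1)}`, `E_1` and `L_1`")] -/
theorem restr_condAvg {S A : Finset ι} (hSA : Disjoint S A) (y : (i : ι) → α i)
    (f : ((i : ι) → α i) → ℝ) : restr S y (condAvg A f) = condAvg A (restr S y f) := by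
  funext x
  unfold restr condAvg
  congr 1
  refine Finset.sum_congr rfl fun z _ => ?_
  congr 1
  funext i
  by_cases hiS : i ∈ S
  · have hiA : i ∉ A := Finset.disjoint_left.1 hSA hiS
    simp [Finset.piecewise, hiS, hiA]
  · simp [Finset.piecewise, hiS]

/-- Restriction on `S` commutes with `L_{S'}` for `S ∩ S' = ∅`. [cite: KellerLifshitzMarcus2023, §3.2.3] -/
theorem restr_lap {S S' : Finset ι} (hSS' : Disjoint S S') (y : (i : ι) → α i)
    (f : ((i : ι) → α i) → ℝ) : restr S y (lap S' f) = lap S' (restr S y f) := by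
  funext x
  unfold lap
  rw [restr]
  refine Finset.sum_congr rfl fun R hR => ?_
  rw [Finset.mem_powerset] at hR
  congr 1
  have := restr_condAvg (hSS'.mono_right hR) y f
  exact congrFun this x

omit [Fintype ι] [∀ i, Fintype (α i)] in
/-- Iterated restriction with the same frozen point: `(f_{S'→y})_{S→y} = f_{S∪S'→y}`.
[cite: KellerLifshitzMarcus2023, §2.2] -/
theorem restr_restr (S S' : Finset ι) (y : (i : ι) → α i) (f : ((i : ι) → α i) → ℝ) :
    restr S y (restr S' y f) = restr (S ∪ S') y f := by
  funext x
  unfold restr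
  congr 1
  funext i
  by_cases hiS : i ∈ S <;> by_cases hiS' : i ∈ S' <;> simp [Finset.piecewise, hiS, hiS']

/-- **Iterated derivatives**: `D_{S,y} D_{S',y} f = D_{S∪S',y} f` for disjoint `S, S'` (a derivative of a
derivative is a derivative). [cite: KellerLifshitzMarcus2023, Thm. 5.2 (proof: "each derivative `D_{S,x}[f^{=d}]` is also a derivative of `D_{i,x}[f^{=d}]`")] -/
theorem deriv_deriv [∀ i, Nonempty (α i)] {S S' : Finset ι} (hSS' : Disjoint S S') (y : (i : ι) → α i)
    (f : ((i : ι) → α i) → ℝ) : deriv S y (deriv S' y f) = deriv (S ∪ S') y f := by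
  unfold deriv
  rw [← restr_lap hSS'.symm, restr_restr, lap_lap]

/-- `E_i` of a derivative in direction `i` vanishes: `E_A D_{S,y} f = D_{S,y} f` for `A ⊆ S` (it does not
depend on `S`) — recorded as `DependsOff`. [cite: KellerLifshitzMarcus2023, §2.2] -/
theorem condAvg_deriv_of_subset [∀ i, Nonempty (α i)] {A S : Finset ι} (hAS : A ⊆ S) (y : (i : ι) → α i)
    (f : ((i : ι) → α i) → ℝ) : condAvg A (deriv S y f) = deriv S y f :=
  ((dependsOff_deriv S y f).mono hAS).condAvg_eq

/-- **The restriction lemma** (one coordinate): for `i ∈ T`, restricting the part `f^{=T}` in the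
coordinate `i` gives the `T ∖ i` part of the derivative: `(f^{=T})_{i→y} = (D_{i,y} f)^{=T∖i}`.
[cite: KellerLifshitzMarcus2023, Thm. 5.2 (proof: "`D_{i,x}[f^{=d}] = (D_{i,x}[f])^{=d-1}`")] -/
theorem restr_esPart [∀ i, Nonempty (α i)] {T : Finset ι} {i : ι} (hi : i ∈ T) (y : (i : ι) → α i)
    (f : ((i : ι) → α i) → ℝ) : restr {i} y (esPart T f) = esPart (T.erase i) (deriv {i} y f) := by
  -- `f^{=T} = (L_i f)^{=T}` for `i ∈ T`; expand, split `R ⊆ T` by `i ∈ R`; the `i ∉ R` terms vanish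
  -- (`E_{Rᶜ} L_i = 0`), the others restrict to `E_{Rᶜ} D_{i,y} f` (restriction commutes with `E_{Rᶜ}`)
  have h0 : esPart T f = esPart T (lap {i} f) := by
    rw [esPart_lap, if_pos (Finset.singleton_subset_iff.2 hi)]
  rw [h0]
  set T' := T.erase i with hT'
  have hT : T = insert i T' := (Finset.insert_erase hi).symm
  have hiT' : i ∉ T' := Finset.notMem_erase i T
  funext x
  unfold esPart
  simp only [restr]
  rw [hT, Finset.sum_powerset_insert hiT', Finset.card_insert_of_notMem hiT']
  have h1 : ∑ R ∈ T'.powerset, (-1 : ℝ) ^ (T'.card + 1 + R.card) *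
      condAvg (univ \ R) (lap {i} f) (({i} : Finset ι).piecewise y x) = 0 := by
    refine Finset.sum_eq_zero fun R hR => ?_
    rw [Finset.mem_powerset] at hR
    have hiR : i ∈ univ \ R := by
      rw [Finset.mem_sdiff]
      exact ⟨Finset.mem_univ _, fun h => hiT' (hR h)⟩
    rw [condAvg_lap_eq_zero hiR (Finset.mem_singleton_self i)]
    simp
  rw [h1, zero_add]
  refine Finset.sum_congr rfl fun R hR => ?_
  rw [Finset.mem_powerset] at hR
  have hiR : i ∉ R := fun h => hiT' (hR h)
  rw [Finset.card_insert_of_notMem hiR]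
  have hsign : (-1 : ℝ) ^ (T'.card + 1 + (R.card + 1)) = (-1 : ℝ) ^ (T'.card + R.card) := by
    rw [show T'.card + 1 + (R.card + 1) = T'.card + R.card + 2 by ring, pow_add]
    norm_num
  rw [hsign]
  congr 1
  -- `E_{(insert i R)ᶜ}` commutes with freezing `i`; and `E_{Rᶜ} D = E_{(insert i R)ᶜ} E_i D = E_{(insert i R)ᶜ} D`
  have hdisj : Disjoint ({i} : Finset ι) (univ \ insert i R) := by
    rw [Finset.disjoint_singleton_left]
    simp
  have h2 := congrFun (restr_condAvg hdisj y (lap {i} f)) x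
  simp only [restr] at h2
  rw [h2]
  have hsplit : (univ : Finset ι) \ R = (univ \ insert i R) ∪ {i} := by
    ext j
    simp only [Finset.mem_sdiff, Finset.mem_univ, true_and, Finset.mem_union, Finset.mem_insert,
      Finset.mem_singleton, not_or]
    constructor
    · intro hjR
      by_cases hji : j = i
      · exact Or.inr hji
      · exact Or.inl ⟨hji, hjR⟩
    · rintro (⟨-, hjR⟩ | hji)
      · exact hjR
      · exact hji ▸ hiR
  rw [hsplit, ← condAvg_condAvg, condAvg_deriv_of_subset le_rfl]
  rfl

omit [Fintype ι] [∀ i, Fintype (α i)] in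
/-- Restriction is linear: finite sums. [cite: KellerLifshitzMarcus2023, §2.2] -/
theorem restr_finset_sum {κ : Type*} (s : Finset κ) (S : Finset ι) (y : (i : ι) → α i)
    (F : κ → ((i : ι) → α i) → ℝ) :
    restr S y (fun x => ∑ k ∈ s, F k x) = fun x => ∑ k ∈ s, restr S y (F k) x := rfl

omit [Fintype ι] [∀ i, Fintype (α i)] in
/-- Restriction is linear: scalars. [cite: KellerLifshitzMarcus2023, §2.2] -/
theorem restr_smul (S : Finset ι) (y : (i : ι) → α i) (c : ℝ) (f : ((i : ι) → α i) → ℝ) :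
    restr S y (fun x => c * f x) = fun x => c * restr S y f x := rfl

omit [Fintype ι] [∀ i, Fintype (α i)] in
/-- If `f` does not depend on `B` then restricting coordinates in `B` does nothing.
[cite: KellerLifshitzMarcus2023, §2.2] -/
theorem DependsOff.restr_eq {B S : Finset ι} {f : ((i : ι) → α i) → ℝ} (h : DependsOff B f) (hSB : S ⊆ B)
    (y : (i : ι) → α i) : restr S y f = f := by
  funext x
  exact (h.mono hSB).piecewise x y

/-- The parts through a coordinate the function does not depend on vanish.
[cite: KellerLifshitzMarcus2023, §2.2] -/
theorem esPart_eq_zero_of_dependsOff [∀ i, Nonempty (α i)] {B T : Finset ι} {f : ((i : ι) → α i) → ℝ}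
    (h : DependsOff B f) (hBT : ¬ Disjoint B T) : esPart T f = fun _ => 0 := by
  rw [← h.condAvg_eq, esPart_condAvg, if_neg hBT]

/-- Reindexing the subsets containing `i` by `T ↦ T.erase i`. [folklore] -/
private theorem sum_filter_mem_eq_sum_filter_notMem {M : Type*} [AddCommMonoid M] (i : ι) (F : Finset ι → M) :
    ∑ T ∈ (univ : Finset (Finset ι)).filter (fun T => i ∈ T), F T =
      ∑ T ∈ (univ : Finset (Finset ι)).filter (fun T => i ∉ T), F (insert i T) := by
  refine Finset.sum_nbij' (fun T => T.erase i) (fun T => insert i T) ?_ ?_ ?_ ?_ ?_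
  · intro T hT; simp
  · intro T hT; simp
  · intro T hT
    simp only [Finset.mem_filter, Finset.mem_univ, true_and] at hT
    exact Finset.insert_erase hT
  · intro T hT
    simp only [Finset.mem_filter, Finset.mem_univ, true_and] at hT
    exact Finset.erase_insert hT
  · intro T hT
    simp only [Finset.mem_filter, Finset.mem_univ, true_and] at hT
    simp only [Finset.insert_erase hT]

/-- A function is the sum of its "`i`-free" parts and its restriction/derivative:
`(∑_{T ∌ i} f^{=T}) = E_i f` and, for `i ∈ T`, restriction acts by `restr_esPart`; packaged:
`(L_i f)_{i→y} = D_{i,y} f` has parts `(D_{i,y} f)^{=T'} ` — recorded as the expansion of a restricted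
`L_i`-image. [cite: KellerLifshitzMarcus2023, §2.2] -/
theorem restr_singleton_of_lap [∀ i, Nonempty (α i)] (i : ι) (y : (i : ι) → α i)
    (c : Finset ι → ℝ) (f : ((i : ι) → α i) → ℝ) :
    restr {i} y (fun x => ∑ T : Finset ι, c T * esPart T (lap {i} f) x) =
      fun x => ∑ T ∈ (univ : Finset (Finset ι)).filter (fun T => i ∉ T),
        c (insert i T) * esPart T (deriv {i} y f) x := by
  -- parts of `L_i f`: `[i ∈ T] f^{=T}`; restrict those with `restr_esPart`, then reindex
  have h1 : (fun x => ∑ T : Finset ι, c T * esPart T (lap {i} f) x) =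
      fun x => ∑ T ∈ (univ : Finset (Finset ι)).filter (fun T => i ∈ T), c T * esPart T f x := by
    funext x
    rw [← Finset.sum_filter_add_sum_filter_not univ (fun T => i ∈ T)]
    have h0 : ∑ T ∈ univ.filter (fun T => ¬ i ∈ T), c T * esPart T (lap {i} f) x = 0 :=
      Finset.sum_eq_zero fun T hT => by
        rw [Finset.mem_filter] at hT
        rw [esPart_lap, if_neg (by simpa using hT.2)]
        simp
    rw [h0, add_zero]
    refine Finset.sum_congr rfl fun T hT => ?_
    rw [Finset.mem_filter] at hT
    rw [esPart_lap, if_pos (by simpa using hT.2)]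
  rw [h1]
  funext x
  change ∑ T ∈ univ.filter (fun T => i ∈ T), c T * esPart T f (({i} : Finset ι).piecewise y x) = _
  rw [sum_filter_mem_eq_sum_filter_notMem i (fun T => c T * esPart T f (({i} : Finset ι).piecewise y x))]
  refine Finset.sum_congr rfl fun T hT => ?_
  rw [Finset.mem_filter] at hT
  congr 1
  have := restr_esPart (Finset.mem_insert_self i T) y f
  rw [Finset.erase_insert hT.2] at this
  exact congrFun this x

/-- **KLM Lemma 2.2 (second identity), one coordinate**: `D_{i,y} T_{ρ,A} f = ρ^{[i ∈ A]} T_{ρ,A} D_{i,y} f`.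
[cite: KellerLifshitzMarcus2023, Lemma 2.2] -/
theorem deriv_singleton_noiseOn [∀ i, Nonempty (α i)] (ρ : ℝ) (A : Finset ι) (i : ι) (y : (i : ι) → α i)
    (f : ((i : ι) → α i) → ℝ) :
    deriv {i} y (noiseOn ρ A f) = fun x => ρ ^ ({i} ∩ A).card * noiseOn ρ A (deriv {i} y f) x := by
  -- `D_i (T f) = (L_i T f)_{i→y} = (T L_i f)_{i→y}`; expand `T L_i f = ∑_T ρ^{|T∩A|} (L_i f)^{=T}`
  unfold deriv
  rw [lap_noiseOn_comm]
  rw [show noiseOn ρ A (lap {i} f) = fun x => ∑ T : Finset ι, ρ ^ (T ∩ A).card * esPart T (lap {i} f) x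
    from rfl, restr_singleton_of_lap]
  funext x
  -- right side: `ρ^{[i∈A]} ∑_{T'} ρ^{|T'∩A|} (D f)^{=T'}`, and the parts with `i ∈ T'` vanish
  change _ = ρ ^ ({i} ∩ A).card * ∑ T : Finset ι, ρ ^ (T ∩ A).card * esPart T (restr {i} y (lap {i} f)) x
  rw [Finset.mul_sum, ← Finset.sum_filter_add_sum_filter_not univ (fun T : Finset ι => i ∈ T)]
  have hvan : ∑ T ∈ univ.filter (fun T : Finset ι => i ∈ T),
      ρ ^ ({i} ∩ A).card * (ρ ^ (T ∩ A).card * esPart T (restr {i} y (lap {i} f)) x) = 0 :=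
    Finset.sum_eq_zero fun T hT => by
      rw [Finset.mem_filter] at hT
      have hz := esPart_eq_zero_of_dependsOff (dependsOff_restr {i} y (lap {i} f)) (T := T)
        (by rw [Finset.disjoint_singleton_left]; exact fun h => h hT.2)
      rw [hz]; simp
  rw [hvan, zero_add]
  refine Finset.sum_congr rfl fun T hT => ?_
  rw [Finset.mem_filter] at hT
  rw [← mul_assoc, ← pow_add]
  congr 2
  · rw [Finset.insert_eq, Finset.union_inter_distrib_right, Finset.card_union_of_disjoint]
    exact Finset.disjoint_left.2 fun j hj hj' => by
      rw [Finset.mem_inter, Finset.mem_singleton] at hj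
      rw [Finset.mem_inter] at hj'
      exact hT.2 (hj.1 ▸ hj'.1)

/-- **KLM Lemma 2.2 (second identity)**: `D_{S,y} T_{ρ,A} f = ρ^{|S ∩ A|} T_{ρ,A} D_{S,y} f`; for
`A = univ`: `D_{S,x} T_ρ f = ρ^{|S|} T_ρ D_{S,x} f`. [cite: KellerLifshitzMarcus2023, Lemma 2.2] -/
theorem deriv_noiseOn [∀ i, Nonempty (α i)] (ρ : ℝ) (A S : Finset ι) (y : (i : ι) → α i)
    (f : ((i : ι) → α i) → ℝ) :
    deriv S y (noiseOn ρ A f) = fun x => ρ ^ (S ∩ A).card * noiseOn ρ A (deriv S y f) x := by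
  induction S using Finset.induction_on with
  | empty =>
    funext x
    simp only [deriv, restr_empty, lap_empty, Finset.empty_inter, Finset.card_empty, pow_zero, one_mul]
  | insert i S hiS ih =>
    have hdisj : Disjoint ({i} : Finset ι) S := Finset.disjoint_singleton_left.2 hiS
    have hins : insert i S = {i} ∪ S := rfl
    rw [hins, ← deriv_deriv hdisj, ← deriv_deriv hdisj, ih]
    have hlin : ∀ (c : ℝ) (g : ((i : ι) → α i) → ℝ),
        deriv {i} y (fun x => c * g x) = fun x => c * deriv {i} y g x := by
      intro c g
      unfold deriv
      rw [lap_smul]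
      rfl
    rw [hlin, deriv_singleton_noiseOn]
    funext x
    simp only
    rw [← mul_assoc, ← pow_add]
    congr 2
    rw [Finset.union_inter_distrib_right,
      Finset.card_union_of_disjoint (hdisj.mono Finset.inter_subset_left Finset.inter_subset_left), add_comm]

/-! ## Degree-`d` parts -/

/-- **The degree-`d` part** `f^{=d} := ∑_{|T| = d} f^{=T}`. [cite: KellerLifshitzMarcus2023, §2.2 ("`f^{=d}`")] -/
def esLevel (d : ℕ) (f : ((i : ι) → α i) → ℝ) (x : (i : ι) → α i) : ℝ :=
  ∑ T ∈ (univ : Finset (Finset ι)).filter (fun T => T.card = d), esPart T f x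

/-- The parts of `f^{=d}`: `(f^{=d})^{=T} = [|T| = d] f^{=T}`. [cite: KellerLifshitzMarcus2023, §2.2] -/
theorem esPart_esLevel [∀ i, Nonempty (α i)] (d : ℕ) (T : Finset ι) (f : ((i : ι) → α i) → ℝ) :
    esPart T (esLevel d f) = if T.card = d then esPart T f else fun _ => 0 := by
  unfold esLevel
  rw [show (fun x => ∑ T' ∈ univ.filter (fun T' : Finset ι => T'.card = d), esPart T' f x) =
      fun x => ∑ T' ∈ univ.filter (fun T' : Finset ι => T'.card = d), (fun x => esPart T' f x) x from rfl,
    esPart_finset_sum]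
  funext x
  split_ifs with hT
  · rw [Finset.sum_eq_single T]
    · rw [show (fun x => esPart T f x) = esPart T f from rfl, esPart_esPart, if_pos rfl]
    · intro T' _ hT'T
      rw [show (fun x => esPart T' f x) = esPart T' f from rfl, esPart_esPart, if_neg hT'T]
    · intro h
      exact absurd (Finset.mem_filter.2 ⟨Finset.mem_univ T, hT⟩) h
  · change _ = (0 : ℝ)
    refine Finset.sum_eq_zero fun T' hT' => ?_
    rw [Finset.mem_filter] at hT'
    have hne : T' ≠ T := fun h => hT (h ▸ hT'.2)
    rw [show (fun x => esPart T' f x) = esPart T' f from rfl, esPart_esPart, if_neg hne]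

/-- **`f^{=d}` is an eigenfunction of the noise operator**: `T_ρ f^{=d} = ρ^d f^{=d}`.
[cite: KellerLifshitzMarcus2023, §2.2 ("the eigenspaces of `T_ρ` are exactly the spaces `V^{=T}`")] -/
theorem noiseOn_univ_esLevel [∀ i, Nonempty (α i)] (ρ : ℝ) (d : ℕ) (f : ((i : ι) → α i) → ℝ) :
    noiseOn ρ univ (esLevel d f) = fun x => ρ ^ d * esLevel d f x := by
  apply eq_of_esPart_eq
  intro T
  rw [esPart_noiseOn, esPart_smul, esPart_esLevel, Finset.inter_univ]
  funext x
  by_cases h : T.card = d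
  · simp only [h, if_true]
  · simp only [h, if_false, mul_zero]

/-- `f^{=d}` of a function not depending on `B` has no parts meeting `B`; in particular it does not
depend on `B` either. [cite: KellerLifshitzMarcus2023, §2.2] -/
theorem dependsOff_esLevel [∀ i, Nonempty (α i)] {B : Finset ι} {f : ((i : ι) → α i) → ℝ}
    (h : DependsOff B f) (d : ℕ) : DependsOff B (esLevel d f) := by
  have h1 : condAvg B (esLevel d f) = esLevel d f := by
    apply eq_of_esPart_eq
    intro T
    rw [esPart_condAvg, esPart_esLevel]
    split_ifs with h2 h3
    · rfl
    · rfl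
    · exact (esPart_eq_zero_of_dependsOff h h2).symm
    · rfl
  intro x x' hxx'
  rw [← h1]
  exact dependsOff_condAvg B _ x x' hxx'

/-- `L_S f^{=d} = ∑_{|T| = d, T ⊇ S} f^{=T}`; in particular its parts. [cite: KellerLifshitzMarcus2023, §2.2] -/
theorem esPart_lap_esLevel [∀ i, Nonempty (α i)] (S T : Finset ι) (d : ℕ) (f : ((i : ι) → α i) → ℝ) :
    esPart T (lap S (esLevel d f)) = if S ⊆ T ∧ T.card = d then esPart T f else fun _ => 0 := by
  rw [esPart_lap, esPart_esLevel]
  by_cases h1 : S ⊆ T <;> by_cases h2 : T.card = d <;>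
    simp only [h1, h2, if_true, if_false, and_true, and_false]

/-- **The identity behind KLM Thm 5.2's induction**: `D_{i,y}[f^{=d}] = (D_{i,y} f)^{=d-1}` (`d ≥ 1`).
[cite: KellerLifshitzMarcus2023, Thm. 5.2 (proof: "`D_{i,x}[f^{=d}] = (D_{i,x}[f])^{=d-1}`")] -/
theorem deriv_esLevel [∀ i, Nonempty (α i)] (i : ι) (y : (i : ι) → α i) (d : ℕ)
    (f : ((i : ι) → α i) → ℝ) :
    deriv {i} y (esLevel (d + 1) f) = esLevel d (deriv {i} y f) := by
  -- `D_i f^{=d+1} = (L_i f^{=d+1})_{i→y}`, `L_i f^{=d+1} = ∑_T [i∈T][|T|=d+1] f^{=T} = ∑_T c_T (L_i f)^{=T}`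
  have hexp : lap {i} (esLevel (d + 1) f) =
      fun x => ∑ T : Finset ι, (if T.card = d + 1 then (1 : ℝ) else 0) * esPart T (lap {i} f) x := by
    apply eq_of_esPart_eq
    intro T
    rw [esPart_lap_esLevel]
    rw [show (fun x => ∑ T' : Finset ι, (if T'.card = d + 1 then (1 : ℝ) else 0) * esPart T' (lap {i} f) x) =
        fun x => ∑ T' ∈ (univ : Finset (Finset ι)),
          (fun x => (if T'.card = d + 1 then (1 : ℝ) else 0) * esPart T' (lap {i} f) x) x from rfl,
      esPart_finset_sum]
    funext x
    rw [Finset.sum_eq_single T]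
    · rw [esPart_smul]
      show _ = (if T.card = d + 1 then (1 : ℝ) else 0) * esPart T (esPart T (lap {i} f)) x
      rw [esPart_esPart, if_pos rfl, esPart_lap]
      by_cases h1 : ({i} : Finset ι) ⊆ T <;> by_cases h2 : T.card = d + 1 <;> simp [h1, h2]
    · intro T' _ hT'
      rw [esPart_smul]
      show (if T'.card = d + 1 then (1 : ℝ) else 0) * esPart T (esPart T' (lap {i} f)) x = 0
      rw [esPart_esPart, if_neg hT']
      simp
    · intro h; exact absurd (Finset.mem_univ T) h
  unfold deriv
  rw [hexp, restr_singleton_of_lap]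
  -- compare Efron–Stein parts: both sides have part `[i ∉ T'] [|T'| = d] (D f)^{=T'}` at `T'`
  apply eq_of_esPart_eq
  intro T'
  rw [esPart_esLevel]
  rw [show (fun x => ∑ T ∈ univ.filter (fun T : Finset ι => i ∉ T),
        (if (insert i T).card = d + 1 then (1 : ℝ) else 0) * esPart T (ProductSpace.deriv {i} y f) x) =
      fun x => ∑ T ∈ univ.filter (fun T : Finset ι => i ∉ T),
        (fun x => (if (insert i T).card = d + 1 then (1 : ℝ) else 0) *
          esPart T (ProductSpace.deriv {i} y f) x) x from rfl, esPart_finset_sum]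
  have hterm : ∀ T : Finset ι, esPart T' (fun x => (if (insert i T).card = d + 1 then (1 : ℝ) else 0) *
      esPart T (ProductSpace.deriv {i} y f) x) =
        fun x => (if (insert i T).card = d + 1 then (1 : ℝ) else 0) *
          (if T = T' then esPart T (ProductSpace.deriv {i} y f) else fun _ => 0) x := by
    intro T
    rw [esPart_smul, esPart_esPart]
  simp_rw [hterm]
  funext x
  by_cases hiT' : i ∈ T'
  · -- every term vanishes (`T ≠ T'` as `i ∉ T`), and `(D f)^{=T'} = 0`
    have hz : esPart T' (ProductSpace.deriv {i} y f) = fun _ => 0 :=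
      esPart_eq_zero_of_dependsOff (dependsOff_deriv {i} y f)
        (by rw [Finset.disjoint_singleton_left]; exact fun h => h hiT')
    rw [Finset.sum_eq_zero]
    · unfold ProductSpace.deriv at hz
      split_ifs
      · rw [hz]
      · rfl
    · intro T hT
      rw [Finset.mem_filter] at hT
      rw [if_neg (fun h : T = T' => hT.2 (h ▸ hiT'))]
      simp
  · rw [Finset.sum_eq_single T']
    · rw [if_pos rfl, Finset.card_insert_of_notMem hiT']
      by_cases hc : T'.card = d
      · rw [if_pos (by rw [hc]), if_pos hc, one_mul]
        rfl
      · rw [if_neg (fun h => hc (by simpa using h)), if_neg hc, zero_mul]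
    · intro T _ hTT'
      rw [if_neg hTT']
      simp
    · intro h
      exact absurd (Finset.mem_filter.2 ⟨Finset.mem_univ T', hiT'⟩) h

end Literature.Combinatorics.Additive.ProductSpace
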